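import Summits.BirchSwinnertonDyer.BirchSwinnertonDyer.Theses.ResidualThetaTransportAtTwo
import Summits.BirchSwinnertonDyer.BirchSwinnertonDyer.Theorems.ResidualThetaTransportAtTwoThetaLayerLambdaCongruenceAtTwoCosocleKanPlus
import HarnessLib

/-!
# Line `birth` for crux `ThetaLayerLambdaCongruenceAtTwo` (stmt-BirchSwinnertonDyer-20688, route ResidualThetaTransportAtTwo) —
# PROPOSED skeleton v14 (width seat bsd-wall-rtt-p3-w3 g10, 2026-08-28T16:5xZ; NOT registered — the LEAD / pen decide):
# the crux BY NAME from ONE print stub, Buzzard 2000 Prop. 2.4 READ ON THE PICARD CARRIER — Hecke self-duality (SD, item 27800) NOT used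

Skeleton of record is v13 (lead g10/g11, sha16 3820413dc2cd5167): stubs {`stub_heckeSelfDual : heckeSelfDual_torsionBy_J0` (SD),
`stub_buzzard : buzzard2000_multiplicityOne_gamma0` (Bz)}, composition `thetaLayerLambdaCongruenceAtTwo_of_sdBz` (w3 g9 p644762).
WHY v14. The only use of SD on the v13 road is the SUB→QUOTIENT conversion of mod-`2` multiplicity one at the eigen-ideal `𝔪₀`
(`exists_fourCosets_periodHomology_of_multiplicityOne`). That conversion is an artefact of the COORDINATE in which the tree typed
Buzzard's theorem: Buzzard (MRL 7 (2000) p. 100) has «`T` … in `End(J(Γ))` generated (via PICARD functoriality)», and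
`J(Γ)[2] = Pic⁰(X₀(N))[2] = H¹(X₀(N); ℤ/2) = Hom(Λ, ℤ/2)` (exponential sequence; Lange–Birkenhake Prop. 5.2.3/5.2.6) with the Picard
action = the transpose of the tree's covariant action on `Λ = periodHomology N` (DDT §1.3 p. 32), so Buzzard's `J(Γ₀(N))[𝔪]` is
`Hom(Λ/𝔪Λ, 𝔽₂)` and «`T/𝔪`-dimension `2`» IS the quotient form `dim_{𝕋/𝔪} Λ/𝔪Λ = 2`. The landed road (this seat):
`…ThetaLayerLambdaCongruenceAtTwoCosocleRoad` (p648059: B4 from the cosocle count, `kTwo_of_dvd_of_mcCosocle`, `of_buzzardHypotheses`) and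
`…ThetaLayerLambdaCongruenceAtTwoCosocleKanPlus` (p649433: `thetaLayerLambdaCongruenceAtTwo_of_cosocleW`, `…_of_cosocleFact`). Mathematics
of the reading confirmed by the reviewer of p648238 and by rtt-p3-w4 g5 (Lines/birth-cosocle-check-w4g5.md: Buzzard p. 104 → Diamond's
CONTRAVARIANT convention «`J[𝔪] ≅ ⊕ Hom(V, μ_ℓ)`»). STATUS OF THE NAME: the Literature typing `buzzard2000_multiplicityOne_gamma0_picard`
(p648238) was REJECTED on policy («one named fact per printed result — propose a REPLACEMENT of the sibling, not an addition»); so the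
stub below carries the Picard-read statement SPELLED OUT (= the hypothesis of `thetaLayerLambdaCongruenceAtTwo_of_cosocleFact` verbatim).
It closes BY NAME the day item 27798's D-audit re-types the fact in the Picard coordinate (then `stub_buzzardPicard := that fact`), and it is
provable from {`buzzard2000_multiplicityOne_gamma0`, `periodHomology_exists_heckeSelfAdjoint_perfectPairing`} today
(`finrank_periodHomology_quotient_eq_two_of_buzzard`) — i.e. v14 is never WORSE than v13 (PUB² ⟹ this stub), and is PUB¹ under the
Picard typing. ONE stub (≤ stubs_max); NO research stub; BSD is not proved by this; nothing here is a theorem of the tree (the stub is `sorry`).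

ALTERNATIVE v14′ (same composition, weaker print-free interface): `stub_cosocleMultOne :` «for `W` globally minimal with `GoodSS W 2`, `L` odd,
all `p ∤ 2L` good, every maximal `𝔪 ∋ 2` of `HeckeRing0 L 2` with `|𝕋/𝔪| = 2` and `T_q − a_q(W) ∈ 𝔪` (`q ∤ L`) has
`dim_{𝕋/𝔪} Λ/𝔪Λ = 2`» (Galois-free, pairing-free; = hypothesis `hcosW` of `thetaLayerLambdaCongruenceAtTwo_of_cosocleW`), with
`ThetaLayerLambdaCongruenceAtTwo_of := thetaLayerLambdaCongruenceAtTwo_of_cosocleW stub_cosocleMultOne`.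

References: [Buzzard2000LevelLoweringModTwo] Prop. 2.4, Def. 2.1–2.2; [LangeBirkenhake1992] Lemma 4.1.1, Prop. 4.6.3, Prop. 5.2.3, Prop. 5.2.6;
[DarmonDiamondTaylor1995] §1.3, Thm. 1.15; [Pollack2003] Conj. 6.3, Prop. 6.18; [GreenbergVatsal2000] §3 (13).
-/

set_option autoImplicit false
-- justification: the `Summit.BirchSwinnertonDyer.BirchSwinnertonDyer.…` path repeats a component (route-file convention)
set_option linter.dupNamespace false

noncomputable section

open scoped MatrixGroups ModularForm NumberField
open CongruenceSubgroup Polynomial IsDedekindDomain Rat.HeightOneSpectrum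
  Literature.NumberTheory.GaloisRepresentations Literature.NumberTheory.EllipticCurves.ModularForms
  Summit.BirchSwinnertonDyer.BirchSwinnertonDyer.Theses.ResidualThetaTransportAtTwo

namespace Summit.BirchSwinnertonDyer.BirchSwinnertonDyer.Cruxes.ThetaLayerLambdaCongruenceAtTwo.Birth

/-- (BzPic) PRINT STUB — Buzzard 2000 Prop. 2.4 (mod-`2` multiplicity one on `Γ₀(N)`, `N` odd) READ ON THE PICARD CARRIER
`J₀(N)[2] = H¹(X₀(N); ℤ/2) = Hom(Λ, ℤ/2)`: hypothesis list VERBATIM that of `buzzard2000_multiplicityOne_gamma0` (item 27798), conclusion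
`dim_{𝕋/𝔪} Λ/𝔪Λ = 2` on `Λ = periodHomologyHecke N`. Never a prover target (print); closes by name once 27798 is typed in this coordinate,
and follows today from {27798 as typed, the intersection pairing} by `finrank_periodHomology_quotient_eq_two_of_buzzard`.
[cite: Buzzard2000LevelLoweringModTwo, Prop. 2.4 and Def. 2.1–2.2 (p. 100–101)] -/
theorem stub_buzzardPicard :
    ∀ (N : ℕ) [NeZero N], Odd N →
      ∀ (𝔪 : Ideal (HeckeRing0 N 2)), 𝔪.IsMaximal → (2 : HeckeRing0 N 2) ∈ 𝔪 →
      ∀ (k : Type) [Field k] [IsAlgClosed k] [TopologicalSpace k] [DiscreteTopology k]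
        (ι : HeckeRing0 N 2 ⧸ 𝔪 →+* k) (ρ : ModPGaloisRep ℚ k 2),
        (∀ v : HeightOneSpectrum (𝓞 ℚ), ¬ ((primesEquiv v : Nat.Primes) : ℕ) ∣ 2 * N →
          ρ.IsUnramifiedAt v ∧
            ρ.HasFrobCharpolyAt v
              (X ^ 2
                - C (ι (Ideal.Quotient.mk 𝔪 (HeckeRing0.T N 2
                    ((primesEquiv v : Nat.Primes) : ℕ) (primesEquiv v : Nat.Primes).2))) * X
                + C (((primesEquiv v : Nat.Primes) : ℕ) : k))) →
        FramedRep.IsIrreducible ρ →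
        (∀ v : HeightOneSpectrum (𝓞 ℚ), ((primesEquiv v : Nat.Primes) : ℕ) = 2 →
          ∀ 𝔓 ∈ v.primesAbove, ∃ σ ∈ 𝔓.decompositionSubgroup (Field.absoluteGaloisGroup ℚ),
            ∀ c : k, ((ρ σ : GL (Fin 2) k) : Matrix (Fin 2) (Fin 2) k) ≠ Matrix.scalar (Fin 2) c) →
        Module.finrank (HeckeRing0 N 2 ⧸ 𝔪)
          (periodHomologyHecke N ⧸ (𝔪 • ⊤ : Submodule (HeckeRing0 N 2) (periodHomologyHecke N))) = 2 := by
  sorry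

/-- THE SKELETON THEOREM (registrar shape): the crux BY NAME from the ONE print stub through the LANDED sorry-free road
`thetaLayerLambdaCongruenceAtTwo_of_cosocleFact` (w3 g10, p649433: Buzzard hypotheses discharged at the eigen-ideal by `of_buzzardHypotheses`,
B4 by counting, (K2) `kTwo_of_dvd_of_mcCosocle`, plus line `plusLineCharTwo_of_mcCosocleW`, FLAT from the CLOSED node `CuspSpanEvenAtTwoOdd_proof`).
[cite: Pollack2003, Conj. 6.3 and Prop. 6.18] -/
theorem ThetaLayerLambdaCongruenceAtTwo_of :
    Summit.BirchSwinnertonDyer.BirchSwinnertonDyer.Theses.ResidualThetaTransportAtTwo.ThetaLayerLambdaCongruenceAtTwo :=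
  Summit.BirchSwinnertonDyer.BirchSwinnertonDyer.Theorems.ThetaLayerLambdaCongruenceAtTwo.thetaLayerLambdaCongruenceAtTwo_of_cosocleFact
    stub_buzzardPicard

end Summit.BirchSwinnertonDyer.BirchSwinnertonDyer.Cruxes.ThetaLayerLambdaCongruenceAtTwo.Birth

end
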